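import Summits.QuantumFields.YangMills.Theorems.ComplexCouplingChannelFreeEnergyWindowChannelStubBeadSlide

/-!
# Patching local free-energy windows along a disc chain

Stub `stub_patchLocalWindows` of line `Sketch` (transport) for crux `FreeEnergyWindowChannel`
(item `stmt-QuantumFields-18842`, route `ComplexCouplingChannel` of `QuantumFields/YangMills`).
Pure one-complex-variable analysis plus plane geometry; no property of the family `Z : ℕ → ℂ → ℂ` is used.

A *window* for `Z` on a set `S` is a function `f` holomorphic on `S` with constants `M, P₁` such that
`Z P z ≠ 0` and `|log ‖Z P z‖ + P⁴ Re f z| ≤ M` for `P ≥ P₁`, `z ∈ S`.  Given local windows around every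
point of an open connected `D` and two points `x, β ∈ D`, we produce ONE window on an open connected
`U ⊆ D` containing `x` and `β`.

Proof.  Two windows patch along an open PRECONNECTED overlap (`exists_window_union`), and windows
restrict to subsets; only these two properties of the window predicate `W` are used
(`exists_chain_patch`).  Join `x` to `β` by a path in `D`, take a Lebesgue number `ℓ = 3ρ` of the cover
of its compact range by the local balls, and centres `c 0 = x, …, c N = β` on the path with consecutive
distances `< ρ`; every `ball (c j) (3ρ)` carries a local window.  The union of the balls `ball (c j) ρ`
may self-overlap non-consecutively, so we patch by STRONG induction on the length `n` of the chain: let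
`k ≤ n` be the LAST index with `dist (c k) (c 0) < 2ρ` (so `k ≥ 1`).  By induction the shifted chain
`c k, …, c n` carries a window on an open connected `U' ∋ c n` with `ball (c k) ρ ⊆ U' ⊆ ⋃_{j ≥ k} ball (c j) ρ`.
The set `V = ball (c 0) ρ ∪ ball (c k) ρ ⊆ ball (c 0) (3ρ)` carries the `0`-th local window, and
`V ∩ U' = ball (c k) ρ` by maximality of `k` (a point of `ball (c 0) ρ ∩ ball (c j) ρ`, `j > k`, would
give `dist (c j) (c 0) < 2ρ`), which is convex; patching gives a window on `V ∪ U'`.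
-/

open Complex Metric Set Filter Topology

namespace Summit.QuantumFields.YangMills.Theorems.FreeEnergyWindowChannel

/-- The last index `k ≤ n` of a chain `c` with `dist (c k) (c 0) < 2ρ`: it exists, is `≥ 1` as soon as
`dist (c 1) (c 0) < 2ρ` and `1 ≤ n`, and all later indices `k < j ≤ n` have `2ρ ≤ dist (c j) (c 0)`. -/
theorem exists_last_index_near {c : ℕ → ℂ} {ρ : ℝ} {n : ℕ} (hn : 1 ≤ n)
    (h1 : dist (c 1) (c 0) < 2 * ρ) :
    ∃ k : ℕ, dist (c k) (c 0) < 2 * ρ ∧ 1 ≤ k ∧ k ≤ n ∧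
      ∀ j : ℕ, k < j → j ≤ n → 2 * ρ ≤ dist (c j) (c 0) :=
  ⟨Nat.findGreatest (fun j => dist (c j) (c 0) < 2 * ρ) n,
    Nat.findGreatest_spec (P := fun j => dist (c j) (c 0) < 2 * ρ) hn h1,
    Nat.le_findGreatest (P := fun j => dist (c j) (c 0) < 2 * ρ) hn h1, Nat.findGreatest_le n,
    fun _ hkj hjn => not_lt.1 (Nat.findGreatest_is_greatest hkj hjn)⟩

/-- Two balls of radius `ρ` whose centres are closer than `2ρ` have a connected union (they share the
midpoint of the centres). -/
theorem isConnected_ball_union_ball {a b : ℂ} {ρ : ℝ} (hρ : 0 < ρ) (hab : dist b a < 2 * ρ) :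
    IsConnected (ball a ρ ∪ ball b ρ) := by
  refine IsConnected.union ⟨(a + b) / 2, ?_, ?_⟩ ⟨nonempty_ball.2 hρ, (convex_ball _ _).isPreconnected⟩
    ⟨nonempty_ball.2 hρ, (convex_ball _ _).isPreconnected⟩
  · rw [mem_ball, dist_eq_norm, show (a + b) / 2 - a = (b - a) / 2 by ring, norm_div, Complex.norm_two,
      ← dist_eq_norm]
    linarith
  · rw [mem_ball, dist_eq_norm, show (a + b) / 2 - b = (a - b) / 2 by ring, norm_div, Complex.norm_two,
      ← dist_eq_norm, dist_comm]
    linarith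

/-- **Chain patching.**  Let `W` be a predicate on subsets of `ℂ` which restricts to subsets and patches
along open sets with preconnected overlap.  If `c 0, …, c n` is a chain with consecutive distances `< ρ`
and `W` holds on every `ball (c j) (3ρ)`, then `W` holds on some open connected `U` with
`ball (c 0) ρ ⊆ U`, `c n ∈ U` and `U ⊆ ⋃_{j ≤ n} ball (c j) ρ`.  Strong induction on `n`, splitting the
chain at the last index `k` with `dist (c k) (c 0) < 2ρ` (see the module docstring). -/
theorem exists_chain_patch {W : Set ℂ → Prop} (hmono : ∀ S T : Set ℂ, T ⊆ S → W S → W T)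
    (hunion : ∀ U B : Set ℂ, IsOpen U → IsOpen B → IsPreconnected (U ∩ B) → W U → W B → W (U ∪ B))
    {ρ : ℝ} (hρ : 0 < ρ) (n : ℕ) :
    ∀ c : ℕ → ℂ, (∀ j < n, dist (c (j + 1)) (c j) < ρ) → (∀ j ≤ n, W (ball (c j) (3 * ρ))) →
      ∃ U : Set ℂ, IsOpen U ∧ IsConnected U ∧ ball (c 0) ρ ⊆ U ∧ c n ∈ U ∧
        (U ⊆ ⋃ (j : ℕ) (_ : j ≤ n), ball (c j) ρ) ∧ W U := by
  induction n using Nat.strong_induction_on with | _ n ih =>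
  intro c hstep hloc
  rcases Nat.eq_zero_or_pos n with rfl | hn
  · exact ⟨ball (c 0) ρ, isOpen_ball, ⟨nonempty_ball.2 hρ, (convex_ball _ _).isPreconnected⟩,
      Subset.rfl, mem_ball_self hρ, fun z hz => mem_iUnion₂.2 ⟨0, le_rfl, hz⟩,
      hmono _ _ (ball_subset_ball (by linarith)) (hloc 0 le_rfl)⟩
  -- the last centre `c k` within `2ρ` of `c 0`
  have h01 : dist (c 1) (c 0) < ρ := hstep 0 hn
  obtain ⟨k, hk0, h1k, hkn, hmax⟩ := exists_last_index_near (ρ := ρ) hn (by linarith)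
  -- the induction hypothesis for the shifted chain `c k, …, c n`
  obtain ⟨U', hU'o, hU'c, hkU', hnU', hU'sub, hWU'⟩ := ih (n - k) (by omega) (fun j => c (k + j))
    (fun j hj => hstep (k + j) (by omega)) (fun j hj => hloc (k + j) (by omega))
  simp only [add_zero] at hkU'
  simp only [Nat.add_sub_cancel' hkn] at hnU'
  have hkk : c k ∈ ball (c k) ρ := mem_ball_self hρ
  -- `V := ball (c 0) ρ ∪ ball (c k) ρ` carries the `0`-th local window
  have hVsub : ball (c 0) ρ ∪ ball (c k) ρ ⊆ ball (c 0) (3 * ρ) := by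
    rintro z (hz | hz)
    · exact ball_subset_ball (by linarith) hz
    · rw [mem_ball] at hz ⊢
      linarith [dist_triangle z (c k) (c 0)]
  -- KEY: the overlap `V ∩ U'` is the ball `ball (c k) ρ`, by maximality of `k`
  have hVU' : (ball (c 0) ρ ∪ ball (c k) ρ) ∩ U' = ball (c k) ρ := by
    refine Subset.antisymm ?_ fun z hz => ⟨Or.inr hz, hkU' hz⟩
    rintro z ⟨hz | hz, hzU'⟩
    · obtain ⟨j, hj, hzj⟩ := mem_iUnion₂.1 (hU'sub hzU')
      rcases Nat.eq_zero_or_pos j with rfl | hj0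
      · simpa using hzj
      · exfalso
        have h2 := hmax (k + j) (by omega) (by omega)
        rw [mem_ball] at hz hzj
        linarith [dist_triangle (c (k + j)) z (c 0), dist_comm z (c (k + j))]
    · exact hz
  refine ⟨ball (c 0) ρ ∪ ball (c k) ρ ∪ U', (isOpen_ball.union isOpen_ball).union hU'o,
    (isConnected_ball_union_ball hρ hk0).union ⟨c k, Or.inr hkk, hkU' hkk⟩ hU'c,
    subset_union_left.trans subset_union_left, Or.inr hnU', ?_,
    hunion _ _ (isOpen_ball.union isOpen_ball) hU'o (by rw [hVU']; exact (convex_ball _ _).isPreconnected)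
      (hmono _ _ hVsub (hloc 0 (Nat.zero_le n))) hWU'⟩
  rintro z ((hz | hz) | hz)
  · exact mem_iUnion₂.2 ⟨0, Nat.zero_le n, hz⟩
  · exact mem_iUnion₂.2 ⟨k, hkn, hz⟩
  · obtain ⟨j, hj, hzj⟩ := mem_iUnion₂.1 (hU'sub hz)
    exact mem_iUnion₂.2 ⟨k + j, by omega, hzj⟩

/-- **Patching local windows** (stub `stub_patchLocalWindows` of line `Sketch`, crux
`FreeEnergyWindowChannel`).  Local windows for `Z` around every point of an open connected `D ⊆ ℂ` give,
for any `x, β ∈ D`, a window on an open connected `U ⊆ D` containing `x` and `β`.  Proof: a path from `x`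
to `β` in `D`, a Lebesgue number `3ρ` of the cover of its compact range by the local balls, a chain of
centres on the path with consecutive distances `< ρ` (uniform continuity of `Path.extend`), and
`exists_chain_patch` for the window predicate (`exists_window_union` patches, restriction is trivial).
No property of `Z` is used. -/
theorem stub_patchLocalWindows :
    ∀ (Z : ℕ → ℂ → ℂ) (D : Set ℂ), IsOpen D → IsConnected D → ∀ x ∈ D, ∀ β ∈ D,
      (∀ y ∈ D, ∃ s : ℝ, 0 < s ∧ Metric.ball y s ⊆ D ∧ ∃ g : ℂ → ℂ, DifferentiableOn ℂ g (Metric.ball y s) ∧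
        ∃ M : ℝ, ∃ P₁ : ℕ, ∀ P : ℕ, P₁ ≤ P → ∀ z ∈ Metric.ball y s,
          Z P z ≠ 0 ∧ |Real.log ‖Z P z‖ + (P : ℝ) ^ 4 * (g z).re| ≤ M) →
      ∃ U : Set ℂ, IsOpen U ∧ IsConnected U ∧ x ∈ U ∧ β ∈ U ∧ U ⊆ D ∧
        ∃ f : ℂ → ℂ, DifferentiableOn ℂ f U ∧ ∃ M : ℝ, ∃ P₁ : ℕ, ∀ P : ℕ, P₁ ≤ P → ∀ z ∈ U,
          Z P z ≠ 0 ∧ |Real.log ‖Z P z‖ + (P : ℝ) ^ 4 * (f z).re| ≤ M := by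
  intro Z D hDo hDc x hx β hβ hloc
  choose! s hs hsD g hg M P₁ hW using hloc
  -- (1) a path from `x` to `β` inside `D`
  have hJ : JoinedIn D x β := (hDo.isConnected_iff_isPathConnected.1 hDc).joinedIn x hx β hβ
  set γ : Path x β := hJ.somePath
  have hγD : range γ ⊆ D := range_subset_iff.2 hJ.somePath_mem
  -- (2) a Lebesgue number `ℓ = 3ρ` of the cover of the compact `range γ` by the local balls
  obtain ⟨ℓ, hℓ0, hℓ⟩ := lebesgue_number_lemma_of_metric (ι := range γ)
    (c := fun y => ball (y : ℂ) (s y)) (isCompact_range γ.continuous) (fun _ => isOpen_ball)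
    (fun p hp => mem_iUnion.2 ⟨⟨p, hp⟩, mem_ball_self (hs p (hγD hp))⟩)
  obtain ⟨ρ, hρ0, h3ρ⟩ : ∃ ρ : ℝ, 0 < ρ ∧ 3 * ρ = ℓ := ⟨ℓ / 3, by positivity, by ring⟩
  -- (3) the centres of the chain (adapted from `exists_exponent_norm_le_on_ball`)
  obtain ⟨η, hη0, hη⟩ := Metric.uniformContinuous_iff.1 γ.uniformContinuous_extend ρ hρ0
  obtain ⟨m, hm⟩ := exists_nat_one_div_lt hη0
  set N : ℕ := m + 1 with hN
  have hN0 : (0 : ℝ) < N := by rw [hN]; positivity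
  have hNinv : 1 / (N : ℝ) < η := by rw [hN]; push_cast; exact hm
  set c : ℕ → ℂ := fun j => γ.extend ((j : ℝ) / N) with hc
  have hcmem : ∀ j, c j ∈ range γ := fun j => by
    rw [← γ.extend_range]; exact mem_range_self _
  have hc0 : c 0 = x := by simp [hc]
  have hcN : c N = β := by
    simp only [hc]
    rw [div_self hN0.ne', Path.extend_one]
  have hstep : ∀ j : ℕ, dist (c (j + 1)) (c j) < ρ := fun j => by
    refine hη ?_
    rw [Real.dist_eq, Nat.cast_succ, show ((j : ℝ) + 1) / N - j / N = 1 / N from by ring,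
      abs_of_pos (by positivity)]
    exact hNinv
  have hcov : ∀ j, ∃ y ∈ D, ball (c j) (3 * ρ) ⊆ ball y (s y) := fun j => by
    obtain ⟨i, hi⟩ := hℓ (c j) (hcmem j)
    exact ⟨i, hγD i.2, by rwa [h3ρ]⟩
  -- (4) patch along the chain
  obtain ⟨U, hUo, hUc, h0U, hNU, hUsub, f, hf, M₀, P₀, hWU⟩ := exists_chain_patch
    (W := fun S => ∃ f : ℂ → ℂ, DifferentiableOn ℂ f S ∧ ∃ A : ℝ, ∃ Q : ℕ, ∀ P : ℕ, Q ≤ P → ∀ z ∈ S,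
      Z P z ≠ 0 ∧ |Real.log ‖Z P z‖ + (P : ℝ) ^ 4 * (f z).re| ≤ A)
    (fun S T hTS ⟨f, hf, A, Q, hw⟩ => ⟨f, hf.mono hTS, A, Q, fun P hP z hz => hw P hP z (hTS hz)⟩)
    (fun U B hU hB hO ⟨f, hf, A, Q, hwf⟩ ⟨f', hf', A', Q', hwg⟩ =>
      exists_window_union hU hB hO hf hf' hwf hwg)
    hρ0 N c (fun j _ => hstep j) (fun j _ => by
      obtain ⟨y, hyD, hy⟩ := hcov j
      exact ⟨g y, (hg y hyD).mono hy, M y, P₁ y, fun P hP z hz => hW y hyD P hP z (hy hz)⟩)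
  refine ⟨U, hUo, hUc, h0U (by rw [hc0]; exact mem_ball_self hρ0), hcN ▸ hNU, fun z hz => ?_,
    f, hf, M₀, P₀, hWU⟩
  obtain ⟨j, -, hzj⟩ := mem_iUnion₂.1 (hUsub hz)
  obtain ⟨y, hyD, hy⟩ := hcov j
  exact hsD y hyD (hy (ball_subset_ball (by linarith) hzj))

end Summit.QuantumFields.YangMills.Theorems.FreeEnergyWindowChannel
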